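import Summits.NavierStokesRegularity.NavierStokesRegularity.Theorems.StrainDoorsDirectionWindowLiouville
import HarnessLib

/-!
# Strain doors, PART M §M24 — GIGA–MIURA / BARKER–PRANGE WITH A FIXED `δ`: Type-I blow-up forces a
# definite oscillation of the vorticity direction at parabolic distances `≤ R√(t₀ − t)`

ROUND 67 of the `ns-regularity-ideate` p1 line (helper lane of `stmt-NavierStokesRegularity-0056`, rung N0;
nothing here is a claim about Navier–Stokes regularity — the theorem EXCLUDES Type-I singular points under a
direction hypothesis; it says nothing about Type II and nothing unconditional).

THE THEOREM (★★★★ `fixedDeltaAlignmentExcludesTypeI_holds`, door N6 of ROUND 66).  For every Type-I rate `M`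
and every range `R > 0` there is `δ₀ = δ₀(M,R) > 0` (the `δ` of §M23's windowed Liouville theorem) with the
following property.  Let `(u,p)` be a suitable weak solution in a parabolic ball `Q(z₀,ρ)` in
Albritton–Barker's class, with a weak gradient and `𝐈(Q(z₀,ρ)) < ∞`, continuous on `Q(z₀,ρ)` and obeying
there the Type-I RATE `|u(t,x)| ≤ M/√(t₀ − t)` — exactly the hypotheses of the tree's local zoom theorem
`LocalTypeIBlowup.exists_typeIAncientMild_zoomLimit`.  If, for some threshold `d`, the vorticity directions
satisfy `|ξ(t,y) − ξ(t,x)| ≤ δ₀` for all same-time pairs of points of `Q(z₀,ρ)` with `|ω(t,x)|, |ω(t,y)| > d`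
and `|y − x| ≤ R√(t₀ − t)`, then `z₀` is NOT a (backward) singular point of `u`.

Compare Giga–Miura 2011 Thm 1.1 [(CA): `|ξ(x,t) − ξ(y,t)| ≤ η(|x − y|)` on `{|ω| > d}`, `η` a modulus;
Rem. (CA′): `η(|x−y|/√(T−t))`] and Barker–Prange 2020 Thm 3 [`sup_{Ω_d ∩ cones} |ξ(x,t) − ξ(y,t)| ≤ Cη(|x−y|)`,
`η` continuous with `η(0) = 0`, under `|u| ≤ M/√(T−t)`]: SAME setting (Type-I rate, high-vorticity region,
parabolic localisation), the MODULUS is replaced by ANY FIXED `δ ≤ δ₀(M,R)`; `δ₀` is ineffective.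

Proof.  Zoom at `z₀` with scales `1/(n+1)` (`exists_typeIAncientMild_zoomLimit`): a subsequence of
`r u(t₀ + r²s, x₀ + r y)` converges on the window `s < −1`, with its curls, to `U ∈ A_M` with a backward
singular point at the origin.  At a pair `(s,x), (s,y)` of the window with `curl U(s) ≠ 0` at both points and
`|y − x| ≤ R√(−s)`, the pre-images lie in `Q(z₀,ρ)` for large `n`, are `R√(t₀ − t)`-close, and have
`|ω| = |r² ω|/r² → ∞ > d`; so the `δ₀`-bound holds for the zoomed directions eventually and passes to the
limit (directions are scale invariant and continuous off the zero set).  §M23 gives `U ≡ 0` on `s < 0`,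
and the zero field has no singular point.

References: Giga–Miura, Comm. Math. Phys. 303 (2011) Thm 1.1; Barker–Prange, arXiv:1906.08225, Thm 3 and §4;
Seregin–Šverák, Comm. PDE 34 (2009) Thm 2.8; Albritton–Barker, J. Math. Fluid Mech. 21 (2019) Def. 2.1.
-/

noncomputable section

-- the summit and its single problem share the name `NavierStokesRegularity` (D-0017 nested layout)
set_option linter.dupNamespace false

open MeasureTheory Set Function Filter Metric Real InnerProductSpace
open _root_.Topology
open scoped ENNReal NNReal RealInnerProductSpace ContDiff
open Literature.Analysis Literature.Analysis.FluidPDE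

namespace Summit.NavierStokesRegularity.NavierStokesRegularity.Theorems.StrainDoors

/-! ### §M24(a) The statement (door N6 of ROUND 66, threshold sign condition dropped) -/

/-- **Door N6 — Giga–Miura / Barker–Prange with a fixed `δ`.**  For all `M`, `R > 0` some `δ₀ > 0` such that:
a suitable weak solution in `Q(z₀,ρ)` (Albritton–Barker class, weak gradient, `𝐈 < ∞`, continuous, Type-I
rate `M`) whose vorticity directions are `δ₀`-close between same-time points of `Q(z₀,ρ)` above a vorticity
threshold `d` and at distance `≤ R√(t₀ − t)` has no backward singular point at `z₀`. -/
def FixedDeltaAlignmentExcludesTypeI : Prop :=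
  ∀ M R : ℝ, 0 < R → ∃ δ₀ : ℝ, 0 < δ₀ ∧
    ∀ (u : ℝ → EuclideanSpace ℝ (Fin 3) → EuclideanSpace ℝ (Fin 3))
      (p : ℝ → EuclideanSpace ℝ (Fin 3) → ℝ)
      (G : ℝ → EuclideanSpace ℝ (Fin 3) → EuclideanSpace ℝ (Fin 3) →L[ℝ] EuclideanSpace ℝ (Fin 3))
      (z₀ : ℝ × EuclideanSpace ℝ (Fin 3)) (ρ d : ℝ), 0 < ρ →
      IsSuitableWeakSolutionInBall ρ z₀ u p →
      HasWeakSpatialGradientOn (parabolicCylinderOpens ρ z₀) u G →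
      typeIBound (parabolicCylinder ρ z₀) u p G < ⊤ →
      ContinuousOn (uncurry u) (parabolicCylinder ρ z₀) →
      (∀ (t : ℝ) (x : EuclideanSpace ℝ (Fin 3)), (t, x) ∈ parabolicCylinder ρ z₀ →
        ‖u t x‖ ≤ M / Real.sqrt (z₀.1 - t)) →
      (∀ (t : ℝ) (x y : EuclideanSpace ℝ (Fin 3)), (t, x) ∈ parabolicCylinder ρ z₀ →
        (t, y) ∈ parabolicCylinder ρ z₀ → d < ‖curl (u t) x‖ → d < ‖curl (u t) y‖ →
        ‖y - x‖ ≤ R * Real.sqrt (z₀.1 - t) →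
          ‖vorticityDirection (curl (u t)) y - vorticityDirection (curl (u t)) x‖ ≤ δ₀) →
      ¬ IsBackwardSingularPoint u z₀

/-! ### §M24(b) The zero field has no singular point -/

/-- A field vanishing on the open lower half-space has no backward singular point at the origin. [folklore] -/
theorem not_isBackwardSingularPoint_zero_of_eq_zero
    {U : ℝ → EuclideanSpace ℝ (Fin 3) → EuclideanSpace ℝ (Fin 3)}
    (hU : ∀ s : ℝ, s < 0 → ∀ y : EuclideanSpace ℝ (Fin 3), U s y = 0) :
    ¬ IsBackwardSingularPoint U 0 := by
  intro h
  have h1 := h 1 one_pos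
  have hbound : ∀ᵐ z ∂(volume.restrict (parabolicCylinder 1 (0 : ℝ × EuclideanSpace ℝ (Fin 3)))),
      ‖uncurry U z‖ ≤ 0 := by
    refine (ae_restrict_iff' (isOpen_parabolicCylinder 1 _).measurableSet).2 (ae_of_all _ fun z hz => ?_)
    rw [mem_parabolicCylinder] at hz
    have ht : z.1 < 0 := by simpa using hz.1.2
    simp [Function.uncurry, hU z.1 ht z.2]
  have hlt : eLpNorm (uncurry U) ∞ (volume.restrict (parabolicCylinder 1 (0 : ℝ × EuclideanSpace ℝ (Fin 3)))) < ⊤ := by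
    rw [eLpNorm_exponent_top]; exact eLpNormEssSup_lt_top_of_ae_bound hbound
  exact hlt.ne h1

/-! ### §M24(c) The theorem -/

/-- ★★★★ **GIGA–MIURA / BARKER–PRANGE WITH A FIXED `δ`** (door N6 of ROUND 66, PROVED): for every Type-I rate
`M` and range `R > 0` there is `δ₀(M,R) > 0` such that a local suitable weak solution with the Type-I rate at
`z₀` whose vorticity directions oscillate by at most `δ₀` between same-time high-vorticity points at parabolic
distance `≤ R√(t₀ − t)` is not singular at `z₀`.  Zoom (`exists_typeIAncientMild_zoomLimit`) + the windowed
fixed-`δ` Liouville theorem (`exists_pos_windowCoherence_liouville`) + «the zero field is not singular».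
[cite: GigaMiura2011, Thm 1.1; BarkerPrange2020Alignment, Thm 3, §4 Steps 2–3 (arXiv:1906.08225);
SereginSverak2009, Thm 2.8; AlbrittonBarker2019, Def. 2.1] -/
theorem fixedDeltaAlignmentExcludesTypeI_holds : FixedDeltaAlignmentExcludesTypeI := by
  intro M R hR
  obtain ⟨δ, hδ, hLiou⟩ := exists_pos_windowCoherence_liouville M hR
  refine ⟨δ, hδ, ?_⟩
  intro u p G z₀ ρ d hρ hball hwg hI hcont hrate hcoh hsing
  -- (1) zoom at `z₀` with scales `1/(n+1)`
  obtain ⟨r₀, hr₀⟩ : ∃ r₀ : ℕ → ℝ, r₀ = fun n : ℕ => 1 / ((n : ℝ) + 1) := ⟨_, rfl⟩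
  have hr₀pos : ∀ n, 0 < r₀ n := fun n => by rw [hr₀]; positivity
  have hr₀0 : Tendsto r₀ atTop (𝓝 0) := by rw [hr₀]; exact tendsto_one_div_add_atTop_nhds_zero_nat (𝕜 := ℝ)
  obtain ⟨φ, hφ, U, P, H, hU, -, -, -, hsingU, -, hlimc⟩ :=
    LocalTypeIBlowup.exists_typeIAncientMild_zoomLimit hρ hball hwg hI hcont hrate hsing hr₀pos hr₀0
  have hr0 : Tendsto (fun j => r₀ (φ j)) atTop (𝓝 0) := hr₀0.comp hφ.tendsto_atTop
  have hrp : ∀ j, 0 < r₀ (φ j) := fun j => hr₀pos _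
  -- (2) the zoom limit is `δ`-coherent on the window
  have hcohU : ∀ s : ℝ, s < -1 → ∀ x y : EuclideanSpace ℝ (Fin 3),
      curl (U s) x ≠ 0 → curl (U s) y ≠ 0 → ‖y - x‖ ≤ R * √(-s) →
        ‖vorticityDirection (curl (U s)) y - vorticityDirection (curl (U s)) x‖ ≤ δ := by
    intro s hs x y hx hy hxy
    have hs0 : 0 < -s := by linarith
    -- pre-images eventually in the cylinder
    have hmem : ∀ w : EuclideanSpace ℝ (Fin 3), ∀ᶠ j in atTop,
        (z₀.1 + r₀ (φ j) ^ 2 * s, z₀.2 + r₀ (φ j) • w) ∈ parabolicCylinder ρ z₀ := by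
      intro w
      have h1 : ∀ᶠ j in atTop, r₀ (φ j) ^ 2 * (-s) < ρ ^ 2 := by
        have hT : Tendsto (fun j => r₀ (φ j) ^ 2 * (-s)) atTop (𝓝 0) := by
          simpa using (hr0.pow 2).mul_const (-s)
        exact hT.eventually_lt_const (pow_pos hρ 2)
      have h2 : ∀ᶠ j in atTop, r₀ (φ j) * ‖w‖ < ρ := by
        have hT : Tendsto (fun j => r₀ (φ j) * ‖w‖) atTop (𝓝 0) := by
          simpa using hr0.mul_const ‖w‖
        exact hT.eventually_lt_const hρ
      filter_upwards [h1, h2] with j hj1 hj2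
      rw [mem_parabolicCylinder]
      refine ⟨⟨by linarith, by nlinarith [pow_pos (hrp j) 2]⟩, ?_⟩
      rw [dist_eq_norm, add_sub_cancel_left, norm_smul, Real.norm_of_nonneg (hrp j).le]
      exact hj2
    -- pre-images eventually above the threshold
    have hhigh : ∀ w : EuclideanSpace ℝ (Fin 3), curl (U s) w ≠ 0 → ∀ᶠ j in atTop,
        d < ‖curl (u (z₀.1 + r₀ (φ j) ^ 2 * s)) (z₀.2 + r₀ (φ j) • w)‖ := by
      intro w hw
      have hc : 0 < ‖curl (U s) w‖ := norm_pos_iff.2 hw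
      have h1 : ∀ᶠ j in atTop,
          ‖curl (U s) w‖ / 2 < ‖r₀ (φ j) ^ 2 • curl (u (z₀.1 + r₀ (φ j) ^ 2 * s)) (z₀.2 + r₀ (φ j) • w)‖ :=
        ((hlimc s hs w).norm).eventually_const_lt (by linarith)
      have h2 : ∀ᶠ j in atTop, r₀ (φ j) ^ 2 * (|d| + 1) < ‖curl (U s) w‖ / 2 := by
        have hT : Tendsto (fun j => r₀ (φ j) ^ 2 * (|d| + 1)) atTop (𝓝 0) := by
          simpa using (hr0.pow 2).mul_const (|d| + 1)
        exact hT.eventually_lt_const (by linarith)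
      filter_upwards [h1, h2] with j hj1 hj2
      by_contra hle
      push Not at hle
      rw [norm_smul, Real.norm_of_nonneg (sq_nonneg _)] at hj1
      have h3 : r₀ (φ j) ^ 2 * ‖curl (u (z₀.1 + r₀ (φ j) ^ 2 * s)) (z₀.2 + r₀ (φ j) • w)‖ ≤
          r₀ (φ j) ^ 2 * (|d| + 1) :=
        mul_le_mul_of_nonneg_left (hle.trans ((le_abs_self d).trans (by linarith))) (sq_nonneg _)
      linarith
    -- the hypothesis at the pre-images, eventually
    have hev : ∀ᶠ j in atTop,
        ‖‖r₀ (φ j) ^ 2 • curl (u (z₀.1 + r₀ (φ j) ^ 2 * s)) (z₀.2 + r₀ (φ j) • y)‖⁻¹ •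
            (r₀ (φ j) ^ 2 • curl (u (z₀.1 + r₀ (φ j) ^ 2 * s)) (z₀.2 + r₀ (φ j) • y)) -
          ‖r₀ (φ j) ^ 2 • curl (u (z₀.1 + r₀ (φ j) ^ 2 * s)) (z₀.2 + r₀ (φ j) • x)‖⁻¹ •
            (r₀ (φ j) ^ 2 • curl (u (z₀.1 + r₀ (φ j) ^ 2 * s)) (z₀.2 + r₀ (φ j) • x))‖ ≤ δ := by
      filter_upwards [hmem x, hmem y, hhigh x hx, hhigh y hy] with j hjx hjy hdx hdy
      -- LANDING NOTE (ns-s30-p1 g6): the text's helper `inv_norm_smul_smul_of_pos₆₇` restates landed lemmas in BOTH its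
      -- forms (ℝ³: a ClockStretchingLaw module; general normed space: `Literature.AlgebraicTopology.SingularHomology.
      -- inv_norm_smul_smul`) — gate `dedup.landed` (p716755) — and importing either module into the NS lane for three
      -- lines is not worth the dependency, so the computation is a local `have`; statements byte-identical.
      have hinv₆₇ : ∀ {c : ℝ}, 0 < c → ∀ v : EuclideanSpace ℝ (Fin 3), ‖c • v‖⁻¹ • (c • v) = ‖v‖⁻¹ • v :=
        fun {c} hc v => by
          by_cases hv : v = 0
          · simp [hv]
          · rw [norm_smul, Real.norm_eq_abs, abs_of_pos hc, mul_inv, smul_smul, mul_comm c⁻¹, mul_assoc,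
              inv_mul_cancel₀ hc.ne', mul_one]
      rw [hinv₆₇ (pow_pos (hrp j) 2), hinv₆₇ (pow_pos (hrp j) 2),
        ← vorticityDirection_apply, ← vorticityDirection_apply]
      refine hcoh _ _ _ hjx hjy hdx hdy ?_
      rw [add_sub_add_left_eq_sub, ← smul_sub, norm_smul, Real.norm_of_nonneg (hrp j).le]
      have hsq : Real.sqrt (z₀.1 - (z₀.1 + r₀ (φ j) ^ 2 * s)) = r₀ (φ j) * √(-s) := by
        rw [show z₀.1 - (z₀.1 + r₀ (φ j) ^ 2 * s) = r₀ (φ j) ^ 2 * (-s) by ring,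
          Real.sqrt_mul (sq_nonneg _), Real.sqrt_sq (hrp j).le]
      rw [hsq]
      calc r₀ (φ j) * ‖y - x‖ ≤ r₀ (φ j) * (R * √(-s)) := mul_le_mul_of_nonneg_left hxy (hrp j).le
        _ = R * (r₀ (φ j) * √(-s)) := by ring
    -- pass to the limit
    have hT : ∀ w : EuclideanSpace ℝ (Fin 3), curl (U s) w ≠ 0 →
        Tendsto (fun j => ‖r₀ (φ j) ^ 2 • curl (u (z₀.1 + r₀ (φ j) ^ 2 * s)) (z₀.2 + r₀ (φ j) • w)‖⁻¹ •
            (r₀ (φ j) ^ 2 • curl (u (z₀.1 + r₀ (φ j) ^ 2 * s)) (z₀.2 + r₀ (φ j) • w))) atTop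
          (𝓝 (vorticityDirection (curl (U s)) w)) := by
      intro w hw
      have h1 := (continuousAt_inv_norm_smul hw).tendsto.comp (hlimc s hs w)
      simpa only [Function.comp_def, vorticityDirection_apply] using h1
    exact le_of_tendsto (((hT y hy).sub (hT x hx)).norm) hev
  -- (3) the windowed Liouville theorem and the singular point of the limit
  exact not_isBackwardSingularPoint_zero_of_eq_zero (hLiou U hU hcohU) hsingU

/-- ★★★★ Unpacked form of `fixedDeltaAlignmentExcludesTypeI_holds` at given `M`, `R`. -/
theorem exists_pos_fixedDeltaAlignment_not_singular (M : ℝ) {R : ℝ} (hR : 0 < R) :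
    ∃ δ₀ : ℝ, 0 < δ₀ ∧
    ∀ (u : ℝ → EuclideanSpace ℝ (Fin 3) → EuclideanSpace ℝ (Fin 3))
      (p : ℝ → EuclideanSpace ℝ (Fin 3) → ℝ)
      (G : ℝ → EuclideanSpace ℝ (Fin 3) → EuclideanSpace ℝ (Fin 3) →L[ℝ] EuclideanSpace ℝ (Fin 3))
      (z₀ : ℝ × EuclideanSpace ℝ (Fin 3)) (ρ d : ℝ), 0 < ρ →
      IsSuitableWeakSolutionInBall ρ z₀ u p →
      HasWeakSpatialGradientOn (parabolicCylinderOpens ρ z₀) u G →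
      typeIBound (parabolicCylinder ρ z₀) u p G < ⊤ →
      ContinuousOn (uncurry u) (parabolicCylinder ρ z₀) →
      (∀ (t : ℝ) (x : EuclideanSpace ℝ (Fin 3)), (t, x) ∈ parabolicCylinder ρ z₀ →
        ‖u t x‖ ≤ M / Real.sqrt (z₀.1 - t)) →
      (∀ (t : ℝ) (x y : EuclideanSpace ℝ (Fin 3)), (t, x) ∈ parabolicCylinder ρ z₀ →
        (t, y) ∈ parabolicCylinder ρ z₀ → d < ‖curl (u t) x‖ → d < ‖curl (u t) y‖ →
        ‖y - x‖ ≤ R * Real.sqrt (z₀.1 - t) →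
          ‖vorticityDirection (curl (u t)) y - vorticityDirection (curl (u t)) x‖ ≤ δ₀) →
      ¬ IsBackwardSingularPoint u z₀ :=
  fixedDeltaAlignmentExcludesTypeI_holds M R hR

end Summit.NavierStokesRegularity.NavierStokesRegularity.Theorems.StrainDoors

end
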